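/-
Copyright (c) 2026 the pub-hodgecm-mathlib formalisation cell (harness21).  Prover seat hodgecm-mathlib-K2E4-p03 (g2), Track B «K2-LIT» ∕ h413
(`stmt-HodgeConjecture-24833`), line `K2_E3_EllipticInputs`, unit U3, line U3-d: FILE C rung C1 — the TRANSVECTION class, DYADIC RESIDUAL part (c): the index `Q²` AT
EVERY transvection of the model, principal level 2, `2 ≠ 0` only.  2026-09-04.
-/
import Summits.HodgeConjecture.HodgeConjecture.Theorems.K2E3TransvectionCentralizerLevelTwoIndex          -- (this seat, parts (a)(b)): `mem_levelTwo_iff`, `relIndex_map_conj_torus_levelTwo_eq_sq`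
import Summits.HodgeConjecture.HodgeConjecture.Theorems.K2E3UnipotentOrbitalScalingTransvectionIndex    -- ★ p855757 (this seat): `subgroupOf_le_and_relIndex_eq_of_conj` (transport); brings ★ part (i) p855558 and the frame ★ p855528
import HarnessLib

/-!
# K2_E3 road (h413), U3-d FILE C, rung C1 «TRANSVECTION CLASS» — DYADIC RESIDUAL (c): (i′) + the index `Q²` AT EVERY TRANSVECTION `u₀` of `M = U(σ, J₀)(K)` for the
# PRINCIPAL LEVEL-2 subgroup, with `2 ≠ 0` in place of `v 2 = 1` (Rogawski 1990 §3.9, §8.1 Prop. 8.1.2 (b); Harish-Chandra 1999 §3.1 Lemma 3.2)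

Cell `pub/hodgecm-mathlib` (D-0151), Track B; U3-d acting assembly lead K2E3-p21 (g2) («part 2 = ‹C1 dyadic residual› → ‹SC-explicit›», 2026-09-03T23:57:52Z); dealer
K2E3-plan (g1).  THIS FILE is ★ p855757 `K2E3UnipotentOrbitalScalingTransvectionIndex` §1 + §3 RE-RUN at principal level 2: the integral level `K₀` (`g, g⁻¹` integral) is
replaced by the level-2 box `K₂ = {g : v((g − 1)ᵢⱼ) ≤ v 2 ∧ v((g⁻¹ − 1)ᵢⱼ) ≤ v 2}` (`= K₀` when `v 2 = 1`) and the count ★ p855657 by the level-2 count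
★ `relIndex_map_conj_torus_levelTwo_eq_sq` (parts (a)(b)); the transport ★ `subgroupOf_le_and_relIndex_eq_of_conj` (pure group theory) is reused by name.
* §1 `map_conj_torus_levelTwo_le` — `d(t) C₂ d(t)⁻¹ ≤ C₂` (GL level).
* §2 `basePoint_data_levelTwo` — in `M`: `d` normalises `Z(n)`, `d(Z(n) ⊓ K₂)d⁻¹ ≤ Z(n) ⊓ K₂` of relative index `Q²`.
* §3 **`exists_conj_and_relIndex_of_transvection_of_two_ne_zero`** — (i′) + `hZ` + for `K := k⁻¹K₂k`: `(K.map (conj h)) ∩ Z(u₀) ≤ K ∩ Z(u₀)` of relative index `Q²` inside `Z(u₀)`;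
  EXACTLY the conclusion of ★ `exists_conj_and_relIndex_of_transvection` with `hv2 : v 2 = 1` ↦ `h2 : (2 : K) ≠ 0` and the level letter `hK₀` ↦ `hK₂`.
THEOREMS ONLY; lane `--supports stmt-HodgeConjecture-24833 --as helper`.  HONEST LABEL: HC_CM is proved only modulo the 7 printed citations (2 remaining named inputs:
hLiu418 = stmt-HodgeConjecture-24832, h413 = stmt-HodgeConjecture-24833) until rung 0 closes; count-neutral helper.

## References
* [Rogawski1990] J. D. Rogawski, *Automorphic Representations of Unitary Groups in Three Variables*, Ann. of Math. Stud. 123 (1990), §3.9 p. 32; §8.1 Prop. 8.1.2 (b) p. 114.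
* [HarishChandra1999AdmissibleDistributions] Harish-Chandra, *Admissible Invariant Distributions on Reductive p-adic Groups*, ULS 16 (1999), §3.1 Lemma 3.2.
* [Weil1982] A. Weil, *Adeles and Algebraic Groups* (1982), Ch. II §2.2.
-/

set_option autoImplicit false
-- the mandated namespace repeats the single-problem summit's segment (`HodgeConjecture.HodgeConjecture`), as in every `Theorems/*.lean` of this sub-problem
set_option linter.dupNamespace false

noncomputable section

open Matrix
open scoped Matrix MatrixGroups Valued WithZero
open Literature.NumberTheory.Automorphic Literature.NumberTheory.Automorphic.UnitaryGroup Literature.NumberTheory.Automorphic.HermitianLattice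
open Literature.NumberTheory.Automorphic.UnitaryLatticeTree Literature.NumberTheory.Weil1982.UnitaryFinTopForm
open Summit.HodgeConjecture.HodgeConjecture.Cruxes.H413.K2E3TransvectionCentralizerLevel
open Summit.HodgeConjecture.HodgeConjecture.Cruxes.H413.K2E3TransvectionCentralizerLevelTwo
open Summit.HodgeConjecture.HodgeConjecture.Cruxes.H413.K2E3TransvectionCentralizerLevelTwoIndex
open Summit.HodgeConjecture.HodgeConjecture.Cruxes.H413.K2E3UnipotentOrbitalScalingTransvection
open Summit.HodgeConjecture.HodgeConjecture.Cruxes.H413.K2E3UnipotentOrbitalScalingTransvectionIndex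

namespace Summit.HodgeConjecture.HodgeConjecture.Cruxes.H413.K2E3UnipotentOrbitalScalingTransvectionDyadic

variable {K : Type*} [Field K] (σ : K →+* K) [Valued K ℤᵐ⁰]

/-! ## §1 `d(t) C₂ d(t)⁻¹ ≤ C₂` -/

/-- **`d(t) C₂ d(t)⁻¹ ≤ C₂`** for the level-2 centraliser `C₂ = Z_U(n(τ)) ∩ K(2)` and `d(t) = diag(t, 1, (σt)⁻¹)` with `σ t = t`, `0 < v t ≤ 1` (`σ` an isometric involution):
`Ad d(t) (diag(α,β,α)·u(x,z)) = diag(α,β,α)·u(tx, t²z)` stays at level 2. [cite: Rogawski1990, §3.9 p. 32] [cite: HarishChandra1999AdmissibleDistributions, §3.1 Lemma 3.2] -/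
theorem map_conj_torus_levelTwo_le (hσ : ∀ a : K, σ (σ a) = a) (hσv : ∀ a : K, Valued.v (σ a) = Valued.v a) {τ t : K} (hτ : τ ≠ 0) (ht : t ≠ 0) (hσt : σ t = t)
    (hvt : Valued.v t ≤ 1) {u d : GL (Fin 3) K} (hu : (u : Matrix (Fin 3) (Fin 3) K) = !![1, 0, τ; 0, 1, 0; 0, 0, 1])
    (hd : (d : Matrix (Fin 3) (Fin 3) K) = Matrix.diagonal ![t, 1, (σ t)⁻¹]) (hd' : ((d⁻¹ : GL (Fin 3) K) : Matrix (Fin 3) (Fin 3) K) = Matrix.diagonal ![t⁻¹, 1, σ t])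
    {C : Subgroup (GL (Fin 3) K)} (hC : ∀ g : GL (Fin 3) K, g ∈ C ↔ g ∈ unitaryGroupOfForm σ ((StdForm.antidiagonal 3).over K) ∧ g * u = u * g ∧
      (∀ i j : Fin 3, Valued.v (((g : Matrix (Fin 3) (Fin 3) K) - 1) i j) ≤ Valued.v (2 : K)) ∧
      (∀ i j : Fin 3, Valued.v ((((g⁻¹ : GL (Fin 3) K) : Matrix (Fin 3) (Fin 3) K) - 1) i j) ≤ Valued.v (2 : K))) :
    C.map (MulAut.conj d).toMonoidHom ≤ C := by
  rintro _ ⟨g, hg, rfl⟩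
  rw [MulEquiv.coe_toMonoidHom, MulAut.conj_apply]
  obtain ⟨α, β, x, z, hα, hβ, hvα1, hvβ1, hrel, hvx, hvz, hgm⟩ := (mem_levelTwo_iff σ hσ hσv hτ hu g).1 ((hC g).1 hg)
  have hα0 : α ≠ 0 := right_ne_zero_of_mul_eq_one hα
  have hβ0 : β ≠ 0 := right_ne_zero_of_mul_eq_one hβ
  obtain ⟨m, hm, -⟩ := exists_units_coe_eq_torusS (K := K) hα0 hβ0
  obtain ⟨n, hn, -⟩ := exists_units_coe_eq_upperTriangularUnipotent x z (-σ x)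
  have hgmn : g = m * n := Units.ext (by rw [Units.val_mul, hm, hn, hgm])
  have hdm : d * m = m * d := Units.ext (by
    rw [Units.val_mul, Units.val_mul, hd, hm, Matrix.diagonal_mul_diagonal, Matrix.diagonal_mul_diagonal]
    congr 1; funext i; fin_cases i <;> simp [mul_comm])
  have hdn : ((d * n * d⁻¹ : GL (Fin 3) K) : Matrix (Fin 3) (Fin 3) K) = !![1, t * x, t * t * z; 0, 1, -σ (t * x); 0, 0, 1] := by
    rw [coe_torusElt_conj_upperTriangularUnipotent σ ht hd hd' hn, hσt, map_mul, hσt, mul_neg]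
  have hconj : d * g * d⁻¹ = m * (d * n * d⁻¹) := by rw [hgmn, ← mul_assoc, hdm]; group
  refine (hC _).2 ((mem_levelTwo_iff σ hσ hσv hτ hu _).2 ⟨α, β, t * x, t * t * z, hα, hβ, hvα1, hvβ1, ?_, ?_, ?_, ?_⟩)
  · rw [map_mul, map_mul, map_mul, hσt]
    linear_combination (t * t) * hrel
  · rw [Valuation.map_mul]; exact (mul_le_mul' hvt hvx).trans_eq (one_mul _)
  · rw [Valuation.map_mul, Valuation.map_mul]
    exact (mul_le_mul' ((mul_le_mul' hvt hvt).trans_eq (one_mul 1)) hvz).trans_eq (one_mul _)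
  · rw [hconj, Units.val_mul, hm, hdn]

/-! ## §2 The base point in `M` at level 2 -/

/-- **THE LEVEL-2 BASE-POINT DATA IN `M`**: for the corner transvection `n ∈ M` (`mat n = n(τ)`, `τ ≠ 0`) and `d = d(t) ∈ M`: `d` normalises `Z(n)`, and for the level-2 box `K₂`
the level `Z(n) ⊓ K₂` satisfies `d(Z(n) ⊓ K₂)d⁻¹ ≤ Z(n) ⊓ K₂` with relative index `Q²` (★ `relIndex_map_conj_torus_levelTwo_eq_sq` and §1 read through `M ≤ GL₃(K)`).
[cite: Rogawski1990, §3.9 p. 32; §8.1 Prop. 8.1.2 (b) p. 114] [cite: HarishChandra1999AdmissibleDistributions, §3.1 Lemma 3.2] -/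
theorem basePoint_data_levelTwo {J : Matrix (Fin 3) (Fin 3) K} (hJ : J = (StdForm.antidiagonal 3).over K) (hσ : ∀ a : K, σ (σ a) = a)
    (hσv : ∀ a : K, Valued.v (σ a) = Valued.v a) (h2 : (2 : K) ≠ 0) {τ t : K} (hτ : τ ≠ 0) (ht : t ≠ 0) (hσt : σ t = t) (hvt : Valued.v t ≤ 1)
    {n d : ↥(unitaryGroupOfForm σ J)} (hn : ((n : GL (Fin 3) K) : Matrix (Fin 3) (Fin 3) K) = !![1, 0, τ; 0, 1, 0; 0, 0, 1])
    (hd : ((d : GL (Fin 3) K) : Matrix (Fin 3) (Fin 3) K) = Matrix.diagonal ![t, 1, (σ t)⁻¹])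
    (hd' : ((((d : GL (Fin 3) K))⁻¹ : GL (Fin 3) K) : Matrix (Fin 3) (Fin 3) K) = Matrix.diagonal ![t⁻¹, 1, σ t])
    {K₀ : Subgroup ↥(unitaryGroupOfForm σ J)} (hK₀ : ∀ g : ↥(unitaryGroupOfForm σ J), g ∈ K₀ ↔
      (∀ i j : Fin 3, Valued.v ((((g : GL (Fin 3) K) : Matrix (Fin 3) (Fin 3) K) - 1) i j) ≤ Valued.v (2 : K)) ∧
      (∀ i j : Fin 3, Valued.v ((((((g : GL (Fin 3) K))⁻¹ : GL (Fin 3) K) : Matrix (Fin 3) (Fin 3) K) - 1) i j) ≤ Valued.v (2 : K)))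
    {O : AddSubgroup K} (hO : ∀ x : K, x ∈ O ↔ Valued.v x ≤ 1) {Om : AddSubgroup K} (hOm : ∀ x : K, x ∈ Om ↔ σ x = -x ∧ Valued.v x ≤ 1)
    {Q : ℕ} (hF1 : (O.map (AddMonoidHom.mulLeft t)).relIndex O = Q) (hFm : (Om.map (AddMonoidHom.mulLeft (t * t))).relIndex Om = Q) :
    (Subgroup.centralizer ({n} : Set ↥(unitaryGroupOfForm σ J))).map (MulAut.conj d).toMonoidHom = Subgroup.centralizer ({n} : Set ↥(unitaryGroupOfForm σ J)) ∧
    (Subgroup.centralizer ({n} : Set ↥(unitaryGroupOfForm σ J)) ⊓ K₀).map (MulAut.conj d).toMonoidHom ≤ Subgroup.centralizer ({n} : Set ↥(unitaryGroupOfForm σ J)) ⊓ K₀ ∧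
    ((Subgroup.centralizer ({n} : Set ↥(unitaryGroupOfForm σ J)) ⊓ K₀).map (MulAut.conj d).toMonoidHom).relIndex
      (Subgroup.centralizer ({n} : Set ↥(unitaryGroupOfForm σ J)) ⊓ K₀) = Q ^ 2 := by
  classical
  subst hJ
  have hdn : (((d * n * d⁻¹ : ↥(unitaryGroupOfForm σ ((StdForm.antidiagonal 3).over K))) : GL (Fin 3) K) : Matrix (Fin 3) (Fin 3) K) = !![1, 0, t * t * τ; 0, 1, 0; 0, 0, 1] := by
    have h := coe_torusElt_conj_cornerUnipotent σ ht hd hd' hn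
    rw [hσt] at h
    simpa only [Subgroup.coe_mul, Subgroup.coe_inv] using h
  -- the GL-level level `C₂` is the image of `Z(n) ⊓ K₂`
  have hC : ∀ g : GL (Fin 3) K, g ∈ (Subgroup.centralizer ({n} : Set ↥(unitaryGroupOfForm σ ((StdForm.antidiagonal 3).over K))) ⊓ K₀).map (unitaryGroupOfForm σ ((StdForm.antidiagonal 3).over K)).subtype ↔
      g ∈ unitaryGroupOfForm σ ((StdForm.antidiagonal 3).over K) ∧ g * (n : GL (Fin 3) K) = (n : GL (Fin 3) K) * g ∧
      (∀ i j : Fin 3, Valued.v (((g : Matrix (Fin 3) (Fin 3) K) - 1) i j) ≤ Valued.v (2 : K)) ∧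
      (∀ i j : Fin 3, Valued.v ((((g⁻¹ : GL (Fin 3) K) : Matrix (Fin 3) (Fin 3) K) - 1) i j) ≤ Valued.v (2 : K)) := by
    intro g
    rw [Subgroup.mem_map]
    constructor
    · rintro ⟨m, hm, rfl⟩
      obtain ⟨hmZ, hmK⟩ := Subgroup.mem_inf.1 hm
      rw [Subgroup.mem_centralizer_singleton_iff] at hmZ
      refine ⟨m.2, ?_, (hK₀ m).1 hmK⟩
      have := congrArg (fun w : ↥(unitaryGroupOfForm σ ((StdForm.antidiagonal 3).over K)) => (w : GL (Fin 3) K)) hmZ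
      simpa only [Subgroup.coe_mul, Subgroup.coe_subtype] using this
    · rintro ⟨hgU, hcomm, hint, hint'⟩
      refine ⟨⟨g, hgU⟩, Subgroup.mem_inf.2 ⟨?_, (hK₀ _).2 ⟨hint, hint'⟩⟩, rfl⟩
      rw [Subgroup.mem_centralizer_singleton_iff]
      exact Subtype.ext (by rw [Subgroup.coe_mul, Subgroup.coe_mul]; exact hcomm)
  have hinj : Function.Injective (unitaryGroupOfForm σ ((StdForm.antidiagonal 3).over K)).subtype := Subgroup.subtype_injective _
  have hmapd : ((Subgroup.centralizer ({n} : Set ↥(unitaryGroupOfForm σ ((StdForm.antidiagonal 3).over K))) ⊓ K₀).map (unitaryGroupOfForm σ ((StdForm.antidiagonal 3).over K)).subtype).map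
        (MulAut.conj (d : GL (Fin 3) K)).toMonoidHom =
      ((Subgroup.centralizer ({n} : Set ↥(unitaryGroupOfForm σ ((StdForm.antidiagonal 3).over K))) ⊓ K₀).map (MulAut.conj d).toMonoidHom).map (unitaryGroupOfForm σ ((StdForm.antidiagonal 3).over K)).subtype := by
    rw [Subgroup.map_map, Subgroup.map_map]
    congr 1
  refine ⟨?_, ?_, ?_⟩
  · -- `d` normalises `Z(n)`
    rw [← K2E3UnipotentAdaptedFrame.centralizer_conj_eq_map]
    ext z
    rw [Subgroup.mem_centralizer_singleton_iff, Subgroup.mem_centralizer_singleton_iff]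
    have httτ : t * t * τ ≠ 0 := mul_ne_zero (mul_ne_zero ht ht) hτ
    constructor
    · intro hz
      have hc : (z : GL (Fin 3) K) * ((d * n * d⁻¹ : ↥(unitaryGroupOfForm σ ((StdForm.antidiagonal 3).over K))) : GL (Fin 3) K) =
          ((d * n * d⁻¹ : ↥(unitaryGroupOfForm σ ((StdForm.antidiagonal 3).over K))) : GL (Fin 3) K) * (z : GL (Fin 3) K) := by
        have := congrArg (fun w : ↥(unitaryGroupOfForm σ ((StdForm.antidiagonal 3).over K)) => (w : GL (Fin 3) K)) hz; simpa only [Subgroup.coe_mul] using this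
      have := commute_cornerUnipotent_of_commute httτ hτ hdn hn hc
      exact Subtype.ext (by simpa only [Subgroup.coe_mul] using this)
    · intro hz
      have hc : (z : GL (Fin 3) K) * (n : GL (Fin 3) K) = (n : GL (Fin 3) K) * (z : GL (Fin 3) K) := by
        have := congrArg (fun w : ↥(unitaryGroupOfForm σ ((StdForm.antidiagonal 3).over K)) => (w : GL (Fin 3) K)) hz; simpa only [Subgroup.coe_mul] using this
      have := commute_cornerUnipotent_of_commute hτ httτ hn hdn hc
      exact Subtype.ext (by simpa only [Subgroup.coe_mul, Subgroup.coe_inv] using this)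
  · -- `dC₂d⁻¹ ≤ C₂` read in `M`
    intro m hm
    have hle0 := map_conj_torus_levelTwo_le σ hσ hσv hτ ht hσt hvt hn hd hd' hC
    have : (m : GL (Fin 3) K) ∈ (Subgroup.centralizer ({n} : Set ↥(unitaryGroupOfForm σ ((StdForm.antidiagonal 3).over K))) ⊓ K₀).map (unitaryGroupOfForm σ ((StdForm.antidiagonal 3).over K)).subtype := by
      apply hle0
      rw [hmapd]
      exact ⟨m, hm, rfl⟩
    obtain ⟨m', hm', hmm'⟩ := this
    rwa [← hinj hmm']
  · -- the count read in `M`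
    rw [← Subgroup.relIndex_map_map_of_injective _ _ hinj, ← hmapd]
    exact relIndex_map_conj_torus_levelTwo_eq_sq σ hσ hσv h2 hτ ht hσt hvt hn hd hd' hC hO hOm hF1 hFm

/-! ## §3 (i′) + the index at every transvection, level 2 -/

/-- **(i′) + THE INDEX `Q²` AT EVERY TRANSVECTION `u₀ ≠ 1` OF `M = U(σ, J₀)(K)`, PRINCIPAL LEVEL 2** (`σ` an isometric involution, ONLY `2 ≠ 0`, `σ t = t`, `0 < v t ≤ 1`;
`K₂ ≤ M` the level-2 box; `hO hOm hF1 hF⁻` the letters of the index bridges): there are `h, k ∈ M` with `mat(h u₀ h⁻¹) = cayley((t·t) • X_{u₀})`, `∀ z, z ∈ Z(u₀) ↔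
h z h⁻¹ ∈ Z(u₀)`, and for `K := k⁻¹ K₂ k`: `(K.map (conj h)) ∩ Z(u₀) ≤ K ∩ Z(u₀)` of relative index `Q²` inside `Z(u₀)` — the conclusion of ★ `exists_conj_and_relIndex_of_transvection`
VERBATIM, every residue characteristic. [cite: Rogawski1990, §3.9 p. 32; §8.1 Prop. 8.1.2 (b) p. 114] [cite: HarishChandra1999AdmissibleDistributions, §3.1 Lemma 3.2] -/
theorem exists_conj_and_relIndex_of_transvection_of_two_ne_zero {J : Matrix (Fin 3) (Fin 3) K} (hJ : J = (StdForm.antidiagonal 3).over K) (hσ : ∀ a : K, σ (σ a) = a)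
    (hσv : ∀ a : K, Valued.v (σ a) = Valued.v a) (h2 : (2 : K) ≠ 0) {t : K} (ht : t ≠ 0) (hσt : σ t = t) (hvt : Valued.v t ≤ 1)
    {K₀ : Subgroup ↥(unitaryGroupOfForm σ J)} (hK₀ : ∀ g : ↥(unitaryGroupOfForm σ J), g ∈ K₀ ↔
      (∀ i j : Fin 3, Valued.v ((((g : GL (Fin 3) K) : Matrix (Fin 3) (Fin 3) K) - 1) i j) ≤ Valued.v (2 : K)) ∧
      (∀ i j : Fin 3, Valued.v ((((((g : GL (Fin 3) K))⁻¹ : GL (Fin 3) K) : Matrix (Fin 3) (Fin 3) K) - 1) i j) ≤ Valued.v (2 : K)))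
    {O : AddSubgroup K} (hO : ∀ x : K, x ∈ O ↔ Valued.v x ≤ 1) {Om : AddSubgroup K} (hOm : ∀ x : K, x ∈ Om ↔ σ x = -x ∧ Valued.v x ≤ 1)
    {Q : ℕ} (hF1 : (O.map (AddMonoidHom.mulLeft t)).relIndex O = Q) (hFm : (Om.map (AddMonoidHom.mulLeft (t * t))).relIndex Om = Q)
    (u₀ : ↥(unitaryGroupOfForm σ J)) (hsq : (((u₀ : GL (Fin 3) K) : Matrix (Fin 3) (Fin 3) K) - 1) * (((u₀ : GL (Fin 3) K) : Matrix (Fin 3) (Fin 3) K) - 1) = 0)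
    (hne : ((u₀ : GL (Fin 3) K) : Matrix (Fin 3) (Fin 3) K) ≠ 1) :
    ∃ h k : ↥(unitaryGroupOfForm σ J),
      (((h * u₀ * h⁻¹ : ↥(unitaryGroupOfForm σ J)) : GL (Fin 3) K) : Matrix (Fin 3) (Fin 3) K) =
          cayley ((t * t) • ((((u₀ : GL (Fin 3) K) : Matrix (Fin 3) (Fin 3) K) - 1) * (((u₀ : GL (Fin 3) K) : Matrix (Fin 3) (Fin 3) K) + 1)⁻¹)) ∧
      (∀ z : ↥(unitaryGroupOfForm σ J), z ∈ Subgroup.centralizer ({u₀} : Set ↥(unitaryGroupOfForm σ J)) ↔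
        h * z * h⁻¹ ∈ Subgroup.centralizer ({u₀} : Set ↥(unitaryGroupOfForm σ J))) ∧
      ((K₀.map (MulAut.conj k⁻¹).toMonoidHom).map (MulAut.conj h).toMonoidHom).subgroupOf (Subgroup.centralizer ({u₀} : Set ↥(unitaryGroupOfForm σ J))) ≤
        (K₀.map (MulAut.conj k⁻¹).toMonoidHom).subgroupOf (Subgroup.centralizer ({u₀} : Set ↥(unitaryGroupOfForm σ J))) ∧
      (((K₀.map (MulAut.conj k⁻¹).toMonoidHom).map (MulAut.conj h).toMonoidHom).subgroupOf (Subgroup.centralizer ({u₀} : Set ↥(unitaryGroupOfForm σ J)))).relIndex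
        ((K₀.map (MulAut.conj k⁻¹).toMonoidHom).subgroupOf (Subgroup.centralizer ({u₀} : Set ↥(unitaryGroupOfForm σ J)))) = Q ^ 2 := by
  subst hJ
  -- the adapted unitary `k`, the corner form `n(τ)` with `τ ≠ 0`, the torus element `d = d(t) ∈ M`, and `h := k⁻¹ d k`
  obtain ⟨k₀, hk₀, τ, -, hkn₀⟩ := exists_conj_coe_eq_cornerUnipotent_of_sq_eq_zero σ hσ u₀.2 hsq
  obtain ⟨k, hk⟩ : ∃ k : ↥(unitaryGroupOfForm σ ((StdForm.antidiagonal 3).over K)), (k : GL (Fin 3) K) = k₀ := ⟨⟨k₀, hk₀⟩, rfl⟩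
  obtain ⟨d₀, hd₀, hd₀'⟩ := exists_units_coe_eq_torusElt σ ht
  have hdU : d₀ ∈ unitaryGroupOfForm σ ((StdForm.antidiagonal 3).over K) := torusElt_mem_unitaryGroupOfForm σ ht (by rw [hσt, hσt]) hd₀
  obtain ⟨d, hdk⟩ : ∃ d : ↥(unitaryGroupOfForm σ ((StdForm.antidiagonal 3).over K)), (d : GL (Fin 3) K) = d₀ := ⟨⟨d₀, hdU⟩, rfl⟩
  have hd : ((d : GL (Fin 3) K) : Matrix (Fin 3) (Fin 3) K) = Matrix.diagonal ![t, 1, (σ t)⁻¹] := by rw [hdk]; exact hd₀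
  have hd' : ((((d : GL (Fin 3) K))⁻¹ : GL (Fin 3) K) : Matrix (Fin 3) (Fin 3) K) = Matrix.diagonal ![t⁻¹, 1, σ t] := by rw [hdk]; exact hd₀'
  have hkn : (((k * u₀ * k⁻¹ : ↥(unitaryGroupOfForm σ ((StdForm.antidiagonal 3).over K))) : GL (Fin 3) K) : Matrix (Fin 3) (Fin 3) K) =
      !![1, 0, τ; 0, 1, 0; 0, 0, 1] := by
    rw [Subgroup.coe_mul, Subgroup.coe_mul, Subgroup.coe_inv, hk]; exact hkn₀
  have hτ : τ ≠ 0 := by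
    intro hτ0
    apply hne
    have hn1 : k * u₀ * k⁻¹ = 1 := Subtype.ext (Units.ext (by
      rw [hkn, hτ0, OneMemClass.coe_one, Units.val_one]; ext i j; fin_cases i <;> fin_cases j <;> simp))
    have : u₀ = 1 := by
      calc u₀ = k⁻¹ * (k * u₀ * k⁻¹) * k := by group
        _ = 1 := by rw [hn1, mul_one, inv_mul_cancel]
    rw [this, OneMemClass.coe_one, Units.val_one]
  -- (i′): `mat(h u₀ h⁻¹) = 1 + t²(mat u₀ − 1)` for `h = k⁻¹ d k`
  have hdn : (((d * (k * u₀ * k⁻¹) * d⁻¹ : ↥(unitaryGroupOfForm σ ((StdForm.antidiagonal 3).over K))) : GL (Fin 3) K) : Matrix (Fin 3) (Fin 3) K) =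
      !![1, 0, t * t * τ; 0, 1, 0; 0, 0, 1] := by
    have e := coe_torusElt_conj_cornerUnipotent σ ht hd hd' hkn
    rw [hσt] at e
    simpa only [Subgroup.coe_mul, Subgroup.coe_inv] using e
  have hkk : ((((k : GL (Fin 3) K))⁻¹ : GL (Fin 3) K) : Matrix (Fin 3) (Fin 3) K) * ((k : GL (Fin 3) K) : Matrix (Fin 3) (Fin 3) K) = 1 := by
    rw [← Units.val_mul, inv_mul_cancel, Units.val_one]
  have hu₀ : ((u₀ : GL (Fin 3) K) : Matrix (Fin 3) (Fin 3) K) =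
      (((k⁻¹ : ↥(unitaryGroupOfForm σ ((StdForm.antidiagonal 3).over K))) : GL (Fin 3) K) : Matrix (Fin 3) (Fin 3) K) * !![1, 0, τ; 0, 1, 0; 0, 0, 1] *
        ((((k⁻¹ : ↥(unitaryGroupOfForm σ ((StdForm.antidiagonal 3).over K))) : GL (Fin 3) K)⁻¹ : GL (Fin 3) K) : Matrix (Fin 3) (Fin 3) K) := by
    rw [← hkn, Subgroup.coe_inv, inv_inv, Subgroup.coe_mul, Subgroup.coe_mul, Subgroup.coe_inv, Units.val_mul, Units.val_mul]
    simp only [← Matrix.mul_assoc, hkk, Matrix.one_mul]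
    rw [Matrix.mul_assoc, hkk, Matrix.mul_one]
  have hconj1 : ((((k⁻¹ * d * k) * u₀ * (k⁻¹ * d * k)⁻¹ : ↥(unitaryGroupOfForm σ ((StdForm.antidiagonal 3).over K))) : GL (Fin 3) K) : Matrix (Fin 3) (Fin 3) K) =
      1 + (t * t) • (((u₀ : GL (Fin 3) K) : Matrix (Fin 3) (Fin 3) K) - 1) := by
    have hgrp : (k⁻¹ * d * k) * u₀ * (k⁻¹ * d * k)⁻¹ = k⁻¹ * (d * (k * u₀ * k⁻¹) * d⁻¹) * k⁻¹⁻¹ := by group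
    rw [hgrp, Subgroup.coe_mul, Subgroup.coe_mul, Subgroup.coe_inv _ k⁻¹, Units.val_mul, Units.val_mul, hdn, hu₀,
      ← conj_one_add_smul_sub_one ((k⁻¹ : ↥(unitaryGroupOfForm σ ((StdForm.antidiagonal 3).over K))) : GL (Fin 3) K) (t * t),
      one_add_smul_cornerUnipotent_sub_one]
  have hZ := mem_centralizer_iff_conj_mem_centralizer_of_coe_conj σ (mul_ne_zero ht ht) hconj1
  -- the base point and the transport
  obtain ⟨hZnd, hle, hidx⟩ := basePoint_data_levelTwo σ rfl hσ hσv h2 hτ ht hσt hvt hkn hd hd' hK₀ hO hOm hF1 hFm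
  obtain ⟨hle', hidx'⟩ := subgroupOf_le_and_relIndex_eq_of_conj
    (Subgroup.centralizer ({k * u₀ * k⁻¹} : Set ↥(unitaryGroupOfForm σ ((StdForm.antidiagonal 3).over K)))) K₀
    (k := k) (d := d) (u₀ := u₀) (h := k⁻¹ * d * k) rfl rfl rfl hZnd hle hidx
  exact ⟨k⁻¹ * d * k, k, by rw [hconj1, cayley_smul_inverseWindow_of_sub_one_mul_self_eq_zero h2 _ hsq], hZ, hle', hidx'⟩

end Summit.HodgeConjecture.HodgeConjecture.Cruxes.H413.K2E3UnipotentOrbitalScalingTransvectionDyadic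

end
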